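import Literature.Barriers.NavierStokesRegularity.SchefferSwitchedPieces
import Literature.Barriers.NavierStokesRegularity.NavierStokesInequalityGluing
import HarnessLib

/-!
# Scheffer's switched field: strips, scaling of the space–time integrals, base finiteness

Barrier-catalogue support file for `NavierStokesRegularity` (D-0021), part of the discharge of
`IsNSIBlock.switching` / `NSISwitching` (Scheffer 1985, Lemma 2.3; Ożański 2017, §2). This file
prepares the **global-in-time integrability** of the glued field `𝔲 = Scheffer.glue T τ z u`
(Ożański 2017, §2: `‖𝔲(t)‖ ≤ sup_{[0,T]}‖u‖`, `∫₀^∞‖∇𝔲‖² = Σⱼ τʲ ∫₀ᵀ‖∇u‖²`; Scheffer 1985,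
(2.34): `‖∇u‖₂² = Σ τ^{j-1}‖∇u¹‖₂²`, `‖u‖₃³ = Σ τ^{2(j-1)}‖u¹‖₃³`, …):

* the `j`-th space–time strip `[t_j, t_{j+1}) × ℝ³` is the preimage of `[0,T) × ℝ³` under the
  affine map `Φⱼ(s, x) = (τ^{-2j}(s - t_j), Γ^{-j}x)` of the `j`-th piece, whose Jacobian factor
  is `τ^{5j}` (`preimage_stAffine_eq_strip`, `jacobian_eq`);
* on the strip the glued field, its slice derivative and the product of its pressure with its
  magnitude are the rescaled pull-backs `τ^{-j}u ∘ Φⱼ`, `τ^{-2j}Du ∘ Φⱼ`, `τ^{-3j}(p̃|u|) ∘ Φⱼ`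
  (`glue_eq_smul_stPull`, `fderiv_glue_eq_smul_stPull`, `pressure_mul_norm_glue_eq_smul_stPull`);
* hence the strip integrals are `τ^{(5-n)j}`, `τ^{3j}`, `τ^{j}`, `τ^{2j}` times the base
  integrals over `[0,T) × ℝ³` (`setLIntegral_strip_enorm_glue_pow`, `…_fderiv_glue`,
  `…_frobeniusNormSq_glue`, `…_pressure_mul_norm_glue`), by the accepted change-of-variables
  lemmas `setLIntegral_enorm_pow_stRescale`, `setLIntegral_frobeniusNormSq_stRescale`
  (`FluidPDE/SpaceTimeRescaling`);
* the base integrals are finite (`base_lt_top_*`): the integrands are continuous on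
  `[0,T] × ℝ³` and vanish off `[0,T] × G`.

The geometric sums and the packaging as `Integrable` statements are in
`SchefferSwitchedIntegrability.lean`.

## References

* W. S. Ożański, arXiv:1709.00602 (2017), §2 p. 7. [`Ozanski2017NSISingular`]
* V. Scheffer, Comm. Math. Phys. 101 (1985), proof of Lemma 2.3, (2.34). [`Scheffer1985`]
-/

noncomputable section

open MeasureTheory Set Function Filter Topology TopologicalSpace Metric Module
open scoped ENNReal InnerProductSpace RealInnerProductSpace ContDiff Laplacian

namespace Literature.Barriers.NavierStokesRegularity

namespace IsNSIBlock

open Scheffer Literature.Analysis.FluidPDE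

variable {T ν₀ τ : ℝ} {z : EuclideanSpace ℝ (Fin 3)} {G : Set (EuclideanSpace ℝ (Fin 3))}
  {u : ℝ → EuclideanSpace ℝ (Fin 3) → EuclideanSpace ℝ (Fin 3)}

/-! ### The strips as preimages and the Jacobian factor -/

/-- **The `j`-th strip is the preimage of `[0, T) × ℝ³`** under the affine map of the `j`-th
piece: `Φⱼ⁻¹([0,T) × ℝ³) = [t_j, t_{j+1}) × ℝ³`. [cite: Ozanski2017NSISingular, §2 (2.4)] -/
theorem preimage_stAffine_eq_strip (h : IsNSIBlock T ν₀ τ z G u) (j : ℕ) :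
    stAffine ((τ⁻¹) ^ (2 * j)) ((τ⁻¹) ^ j) (-((τ⁻¹) ^ (2 * j) * switchTime T τ j))
        ((1 - (τ⁻¹) ^ j) • (1 - τ)⁻¹ • z) ⁻¹' (Ico 0 T ×ˢ (univ : Set (EuclideanSpace ℝ (Fin 3)))) =
      Ico (switchTime T τ j) (switchTime T τ (j + 1)) ×ˢ univ := by
  have hβ : 0 < (τ⁻¹) ^ (2 * j) := h.inv_tau_pow_pos _
  have hinv : (τ⁻¹) ^ (2 * j) * τ ^ (2 * j) = 1 := by
    rw [inv_pow, inv_mul_cancel₀ (pow_ne_zero _ h.τ_pos.ne')]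
  ext ⟨s, x⟩
  simp only [mem_preimage, stAffine_apply, mem_prod, mem_Ico, mem_univ, and_true, switchTime_succ]
  have e : -((τ⁻¹) ^ (2 * j) * switchTime T τ j) + (τ⁻¹) ^ (2 * j) * s =
      (τ⁻¹) ^ (2 * j) * (s - switchTime T τ j) := by ring
  rw [e]
  constructor
  · rintro ⟨h1, h2⟩
    refine ⟨by nlinarith [mul_nonneg_iff_of_pos_left hβ |>.1 h1], ?_⟩
    have h3 : (τ⁻¹) ^ (2 * j) * (s - switchTime T τ j) * τ ^ (2 * j) < T * τ ^ (2 * j) :=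
      mul_lt_mul_of_pos_right h2 (pow_pos h.τ_pos _)
    have h4 : (τ⁻¹) ^ (2 * j) * (s - switchTime T τ j) * τ ^ (2 * j) = s - switchTime T τ j := by
      rw [mul_comm ((τ⁻¹) ^ (2 * j)), mul_assoc, hinv, mul_one]
    linarith
  · rintro ⟨h1, h2⟩
    refine ⟨mul_nonneg hβ.le (by linarith), ?_⟩
    calc (τ⁻¹) ^ (2 * j) * (s - switchTime T τ j)
        < (τ⁻¹) ^ (2 * j) * (T * τ ^ (2 * j)) := mul_lt_mul_of_pos_left (by linarith) hβ
      _ = T := by rw [mul_comm T, ← mul_assoc, hinv, one_mul]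

/-- **The Jacobian factor of the `j`-th affine map is `τ^{5j}`**:
`(τ^{-2j} (τ^{-j})³)⁻¹ = τ^{5j}`. [folklore] -/
theorem jacobian_eq (τ : ℝ) (j : ℕ) :
    ((τ⁻¹) ^ (2 * j) * ((τ⁻¹) ^ j) ^ finrank ℝ (EuclideanSpace ℝ (Fin 3)))⁻¹ = τ ^ (5 * j) := by
  rw [finrank_euclideanSpace_fin, ← pow_mul, ← pow_add, inv_pow, inv_inv]
  congr 1
  ring

/-- Powers of `τ⁻¹` against the Jacobian: `(τ^{-j})ⁿ τ^{5j} = τ^{(5-n)j}` for `n ≤ 5`. [folklore] -/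
theorem inv_pow_mul_jacobian {τ : ℝ} (hτ : τ ≠ 0) {n : ℕ} (hn : n ≤ 5) (j : ℕ) :
    ((τ⁻¹) ^ j) ^ n * τ ^ (5 * j) = τ ^ ((5 - n) * j) := by
  rw [← pow_mul, inv_pow]
  have e : 5 * j = j * n + (5 - n) * j := by
    zify [hn]
    ring
  rw [e, pow_add, ← mul_assoc, inv_mul_cancel₀ (pow_ne_zero _ hτ), one_mul]

/-! ### Joint continuity and vanishing of the base fields on `[0, T] × ℝ³` -/

/-- `u` is jointly continuous on `[0,T] × ℝ³`. [folklore] -/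
theorem continuousOn_uncurry (h : IsNSIBlock T ν₀ τ z G u) :
    ContinuousOn (uncurry u) (Icc 0 T ×ˢ univ) := by
  obtain ⟨η, hη, hs⟩ := h.smooth
  exact hs.continuousOn.mono (prod_mono (fun t ht => ⟨by linarith [ht.1], by linarith [ht.2]⟩) Subset.rfl)

/-- The slice derivative `D u` is jointly continuous on `[0,T] × ℝ³`. [folklore] -/
theorem continuousOn_fderiv_slice (h : IsNSIBlock T ν₀ τ z G u) :
    ContinuousOn (fun q : ℝ × EuclideanSpace ℝ (Fin 3) => fderiv ℝ (u q.1) q.2) (Icc 0 T ×ˢ univ) := by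
  obtain ⟨η, hη, hs⟩ := h.smooth
  have h1 := continuousOn_fderiv_slice_of_contDiffOn (hs.of_le (by
    change ((1 : ℕ∞) : WithTop ℕ∞) ≤ ((⊤ : ℕ∞) : WithTop ℕ∞); exact_mod_cast le_top))
    (isOpen_Ioo.uniqueDiffOn)
  exact h1.mono (prod_mono (fun t ht => ⟨by linarith [ht.1], by linarith [ht.2]⟩) Subset.rfl)

/-- The pressure `p̃[u(t)](x)` is jointly continuous on `[0,T] × ℝ³` (the tree's
`continuousOn_normalisedPressure_slice`). [folklore] -/
theorem continuousOn_normalisedPressure (h : IsNSIBlock T ν₀ τ z G u) :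
    ContinuousOn (fun q : ℝ × EuclideanSpace ℝ (Fin 3) => normalisedPressure (u q.1) q.2)
      (Icc 0 T ×ˢ univ) := by
  obtain ⟨η, hη, hs⟩ := h.smooth
  refine continuousOn_normalisedPressure_slice
    (hs.mono fun t ht => ⟨by linarith [ht.1], by linarith [ht.2]⟩) (uniqueDiffOn_Icc h.T_pos)
    h.isCompact fun t ht x hx => ?_
  rw [← h.tsupport_eq t ht] at hx
  exact image_eq_zero_of_notMem_tsupport hx

/-- `u(t, x) = 0` for `x ∉ G`, `t ∈ [0,T]`. [folklore] -/
theorem apply_eq_zero_of_notMem (h : IsNSIBlock T ν₀ τ z G u) {t : ℝ} (ht : t ∈ Icc 0 T)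
    {x : EuclideanSpace ℝ (Fin 3)} (hx : x ∉ G) : u t x = 0 := by
  rw [← h.tsupport_eq t ht] at hx
  exact image_eq_zero_of_notMem_tsupport hx

/-- `D u(t, x) = 0` for `x ∉ G`, `t ∈ [0,T]` (`u(t)` vanishes on the open set `Gᶜ`). [folklore] -/
theorem fderiv_slice_eq_zero_of_notMem (h : IsNSIBlock T ν₀ τ z G u) {t : ℝ} (ht : t ∈ Icc 0 T)
    {x : EuclideanSpace ℝ (Fin 3)} (hx : x ∉ G) : fderiv ℝ (u t) x = 0 := by
  rw [← h.tsupport_eq t ht] at hx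
  exact fderiv_of_notMem_tsupport ℝ hx

/-! ### Finiteness of the base integrals over `[0, T) × ℝ³` -/

/-- A field continuous on `[0,T] × ℝ³` and vanishing off `[0,T] × G` has
`∫⁻_{[0,T) × ℝ³} ‖F‖ₑ < ∞`. [folklore] -/
theorem setLIntegral_Ico_prod_lt_top_of_continuousOn (h : IsNSIBlock T ν₀ τ z G u)
    {X : Type*} [NormedAddCommGroup X] [NormedSpace ℝ X] {F : ℝ × EuclideanSpace ℝ (Fin 3) → X}
    (hF : ContinuousOn F (Icc 0 T ×ˢ univ)) (hF0 : ∀ t ∈ Icc 0 T, ∀ x ∉ G, F (t, x) = 0) :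
    ∫⁻ q in Ico 0 T ×ˢ (univ : Set (EuclideanSpace ℝ (Fin 3))), ‖F q‖ₑ < ⊤ := by
  have hint := integrable_prod_of_continuousOn (a := 0) (b := T) h.isCompact hF hF0
  rw [Measure.restrict_prod_eq_prod_univ, ← Measure.volume_eq_prod] at hint
  have h1 : ∫⁻ q in Ioo 0 T ×ˢ (univ : Set (EuclideanSpace ℝ (Fin 3))), ‖F q‖ₑ < ⊤ := hint.2
  rwa [setLIntegral_congr (Ico_prod_ae_eq_Ioo_prod (E := EuclideanSpace ℝ (Fin 3)) 0 T)]

/-- **Base finiteness for powers of the velocity**: `∫⁻_{[0,T) × ℝ³} ‖u‖ₑⁿ < ∞`. [cite: Scheffer1985, proof of Lemma 2.3 (2.34)] -/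
theorem base_lt_top_norm_pow (h : IsNSIBlock T ν₀ τ z G u) {n : ℕ} (hn : n ≠ 0) :
    ∫⁻ q in Ico 0 T ×ˢ (univ : Set (EuclideanSpace ℝ (Fin 3))), ‖u q.1 q.2‖ₑ ^ n < ⊤ := by
  have h1 := h.setLIntegral_Ico_prod_lt_top_of_continuousOn (F := fun q => ‖u q.1 q.2‖ ^ n)
    ((h.continuousOn_uncurry.norm).pow n) fun t ht x hx => by
      simp [h.apply_eq_zero_of_notMem ht hx, zero_pow hn]
  refine lt_of_le_of_lt (le_of_eq (lintegral_congr fun q => ?_)) h1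
  rw [Real.enorm_eq_ofReal (by positivity), ENNReal.ofReal_pow (norm_nonneg _), ofReal_norm]

/-- **Base finiteness for the slice derivative**: `∫⁻_{[0,T) × ℝ³} ‖Du‖ₑ < ∞`. [folklore] -/
theorem base_lt_top_fderiv (h : IsNSIBlock T ν₀ τ z G u) :
    ∫⁻ q in Ico 0 T ×ˢ (univ : Set (EuclideanSpace ℝ (Fin 3))), ‖fderiv ℝ (u q.1) q.2‖ₑ < ⊤ :=
  h.setLIntegral_Ico_prod_lt_top_of_continuousOn h.continuousOn_fderiv_slice
    fun _ ht _ hx => h.fderiv_slice_eq_zero_of_notMem ht hx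

/-- **Base finiteness for the dissipation**: `∫⁻_{[0,T) × ℝ³} |Du|² < ∞` (squared Frobenius norm).
[cite: Ozanski2017NSISingular, §2 p. 7] -/
theorem base_lt_top_frobeniusNormSq (h : IsNSIBlock T ν₀ τ z G u) :
    ∫⁻ q in Ico 0 T ×ˢ (univ : Set (EuclideanSpace ℝ (Fin 3))),
      ENNReal.ofReal (frobeniusNormSq (fderiv ℝ (u q.1) q.2)) < ⊤ := by
  have h1 := h.setLIntegral_Ico_prod_lt_top_of_continuousOn
    (F := fun q => frobeniusNormSq (fderiv ℝ (u q.1) q.2))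
    (LerayHopfProofs.continuous_frobeniusNormSq.comp_continuousOn h.continuousOn_fderiv_slice)
    fun t ht x hx => by simp [h.fderiv_slice_eq_zero_of_notMem ht hx, frobeniusNormSq_zero]
  refine lt_of_le_of_lt (le_of_eq (lintegral_congr fun q => ?_)) h1
  rw [Real.enorm_eq_ofReal (frobeniusNormSq_nonneg _)]

/-- **Base finiteness for the pressure term**: `∫⁻_{[0,T) × ℝ³} |p̃[u]| |u| < ∞`. [folklore] -/
theorem base_lt_top_pressure_mul_norm (h : IsNSIBlock T ν₀ τ z G u) :
    ∫⁻ q in Ico 0 T ×ˢ (univ : Set (EuclideanSpace ℝ (Fin 3))),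
      ‖normalisedPressure (u q.1) q.2 * ‖u q.1 q.2‖‖ₑ < ⊤ :=
  h.setLIntegral_Ico_prod_lt_top_of_continuousOn
    (F := fun q => normalisedPressure (u q.1) q.2 * ‖u q.1 q.2‖)
    (h.continuousOn_normalisedPressure.mul h.continuousOn_uncurry.norm)
    fun t ht x hx => by simp [h.apply_eq_zero_of_notMem ht hx]

/-! ### The glued field on the strips as rescaled pull-backs -/

/-- On the `j`-th strip the glued field is the rescaled pull-back `τ^{-j} u ∘ Φⱼ`. [cite: Ozanski2017NSISingular, §2 (2.4)] -/
theorem glue_eq_smul_stPull (h : IsNSIBlock T ν₀ τ z G u) {j : ℕ} {s : ℝ}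
    (hs : s ∈ Ico (switchTime T τ j) (switchTime T τ (j + 1))) (x : EuclideanSpace ℝ (Fin 3)) :
    glue T τ z u s x = ((τ⁻¹) ^ j • stPull ((τ⁻¹) ^ (2 * j)) ((τ⁻¹) ^ j)
      (-((τ⁻¹) ^ (2 * j) * switchTime T τ j)) ((1 - (τ⁻¹) ^ j) • (1 - τ)⁻¹ • z) u) s x := by
  rw [glue_eq_piece h.T_pos h.τ_pos z u hs]
  rfl

/-- On the `j`-th strip the slice derivative of the glued field is `τ^{-2j} Du ∘ Φⱼ`. [folklore] -/
theorem fderiv_glue_eq_smul_stPull (h : IsNSIBlock T ν₀ τ z G u) {j : ℕ} {s : ℝ}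
    (hs : s ∈ Ico (switchTime T τ j) (switchTime T τ (j + 1))) (x : EuclideanSpace ℝ (Fin 3)) :
    fderiv ℝ (glue T τ z u s) x = (((τ⁻¹) ^ j * (τ⁻¹) ^ j) • stPull ((τ⁻¹) ^ (2 * j)) ((τ⁻¹) ^ j)
      (-((τ⁻¹) ^ (2 * j) * switchTime T τ j)) ((1 - (τ⁻¹) ^ j) • (1 - τ)⁻¹ • z)
        (fun r y => fderiv ℝ (u r) y)) s x := by
  rw [glue_eq_piece h.T_pos h.τ_pos z u hs]
  have hσ := h.localTime_mem (Ico_subset_Icc_self hs)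
  have hu1 : ContDiff ℝ 1 (u (-((τ⁻¹) ^ (2 * j) * switchTime T τ j) + (τ⁻¹) ^ (2 * j) * s)) :=
    (h.contDiff_slice hσ).of_le (by norm_cast)
  have hd : DifferentiableAt ℝ (stPull ((τ⁻¹) ^ (2 * j)) ((τ⁻¹) ^ j)
      (-((τ⁻¹) ^ (2 * j) * switchTime T τ j)) ((1 - (τ⁻¹) ^ j) • (1 - τ)⁻¹ • z) u s) x :=
    differentiable_stPull_slice (hu1.differentiable (by simp)) x
  rw [piece, show ((τ⁻¹) ^ j • stPull ((τ⁻¹) ^ (2 * j)) ((τ⁻¹) ^ j)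
      (-((τ⁻¹) ^ (2 * j) * switchTime T τ j)) ((1 - (τ⁻¹) ^ j) • (1 - τ)⁻¹ • z) u) s =
      (τ⁻¹) ^ j • stPull ((τ⁻¹) ^ (2 * j)) ((τ⁻¹) ^ j)
        (-((τ⁻¹) ^ (2 * j) * switchTime T τ j)) ((1 - (τ⁻¹) ^ j) • (1 - τ)⁻¹ • z) u s from rfl,
    fderiv_const_smul hd, fderiv_stPull, smul_smul]
  rfl

/-- On the `j`-th strip, `p̃[𝔲(s)](x) |𝔲(s,x)| = τ^{-3j} (p̃[u] |u|)(Φⱼ(s,x))`. [folklore] -/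
theorem pressure_mul_norm_glue_eq_smul_stPull (h : IsNSIBlock T ν₀ τ z G u) {j : ℕ} {s : ℝ}
    (hs : s ∈ Ico (switchTime T τ j) (switchTime T τ (j + 1))) (x : EuclideanSpace ℝ (Fin 3)) :
    normalisedPressure (glue T τ z u s) x * ‖glue T τ z u s x‖ =
      (((τ⁻¹) ^ j) ^ 3 • stPull ((τ⁻¹) ^ (2 * j)) ((τ⁻¹) ^ j)
        (-((τ⁻¹) ^ (2 * j) * switchTime T τ j)) ((1 - (τ⁻¹) ^ j) • (1 - τ)⁻¹ • z)
        (fun r y => normalisedPressure (u r) y * ‖u r y‖)) s x := by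
  rw [glue_eq_piece h.T_pos h.τ_pos z u hs, h.normalisedPressure_piece j s x, piece_apply]
  simp only [smul_stPull_apply, smul_eq_mul, norm_smul, Real.norm_of_nonneg (h.inv_tau_pow_pos j).le]
  have e : (1 - (τ⁻¹) ^ j) • (1 - τ)⁻¹ • z + (τ⁻¹) ^ j • x =
      (1 - τ)⁻¹ • z + (τ⁻¹) ^ j • (x - (1 - τ)⁻¹ • z) := by
    rw [sub_smul, one_smul, smul_sub, smul_comm ((τ⁻¹) ^ j) ((1 - τ)⁻¹) z]
    abel
  rw [e]
  ring

/-! ### The strip integrals -/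

/-- **Strip integral of powers of the glued field**:
`∫⁻_{[t_j,t_{j+1}) × ℝ³} ‖𝔲‖ₑⁿ = τ^{(5-n)j} ∫⁻_{[0,T) × ℝ³} ‖u‖ₑⁿ` for `n ≤ 5`
(Scheffer 1985, (2.34): `‖u‖₃³ = Σ τ^{2(j-1)}‖u¹‖₃³`). [cite: Scheffer1985, proof of Lemma 2.3 (2.34)] -/
theorem setLIntegral_strip_enorm_glue_pow (h : IsNSIBlock T ν₀ τ z G u) (j : ℕ) {n : ℕ} (hn : n ≤ 5) :
    ∫⁻ q in Ico (switchTime T τ j) (switchTime T τ (j + 1)) ×ˢ (univ : Set (EuclideanSpace ℝ (Fin 3))),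
        ‖glue T τ z u q.1 q.2‖ₑ ^ n =
      ENNReal.ofReal (τ ^ ((5 - n) * j)) *
        ∫⁻ q in Ico 0 T ×ˢ (univ : Set (EuclideanSpace ℝ (Fin 3))), ‖u q.1 q.2‖ₑ ^ n := by
  rw [setLIntegral_congr_fun (measurableSet_Ico.prod MeasurableSet.univ)
    (fun q hq => by rw [h.glue_eq_smul_stPull (mem_prod.1 hq).1 q.2]), ← h.preimage_stAffine_eq_strip j,
    setLIntegral_enorm_pow_stRescale (h.inv_tau_pow_pos _) (h.inv_tau_pow_pos _), jacobian_eq,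
    Real.enorm_eq_ofReal (h.inv_tau_pow_pos j).le, ← ENNReal.ofReal_pow (h.inv_tau_pow_pos j).le,
    ← ENNReal.ofReal_mul (pow_nonneg (h.inv_tau_pow_pos j).le n), inv_pow_mul_jacobian h.τ_pos.ne' hn]

/-- **Strip integral of the slice derivative**:
`∫⁻_{[t_j,t_{j+1}) × ℝ³} ‖D𝔲‖ₑ = τ^{3j} ∫⁻_{[0,T) × ℝ³} ‖Du‖ₑ`. [folklore] -/
theorem setLIntegral_strip_enorm_fderiv_glue (h : IsNSIBlock T ν₀ τ z G u) (j : ℕ) :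
    ∫⁻ q in Ico (switchTime T τ j) (switchTime T τ (j + 1)) ×ˢ (univ : Set (EuclideanSpace ℝ (Fin 3))),
        ‖fderiv ℝ (glue T τ z u q.1) q.2‖ₑ =
      ENNReal.ofReal (τ ^ (3 * j)) *
        ∫⁻ q in Ico 0 T ×ˢ (univ : Set (EuclideanSpace ℝ (Fin 3))), ‖fderiv ℝ (u q.1) q.2‖ₑ := by
  have h1 := setLIntegral_enorm_pow_stRescale (F := EuclideanSpace ℝ (Fin 3) →L[ℝ] EuclideanSpace ℝ (Fin 3))
    (h.inv_tau_pow_pos (2 * j)) (h.inv_tau_pow_pos j) (-((τ⁻¹) ^ (2 * j) * switchTime T τ j))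
    ((1 - (τ⁻¹) ^ j) • (1 - τ)⁻¹ • z) ((τ⁻¹) ^ j * (τ⁻¹) ^ j) (fun r y => fderiv ℝ (u r) y)
    (Ico 0 T ×ˢ univ) 1
  simp only [pow_one] at h1
  rw [setLIntegral_congr_fun (measurableSet_Ico.prod MeasurableSet.univ)
    (fun q hq => by rw [h.fderiv_glue_eq_smul_stPull (mem_prod.1 hq).1 q.2]),
    ← h.preimage_stAffine_eq_strip j, h1, jacobian_eq,
    Real.enorm_eq_ofReal (mul_pos (h.inv_tau_pow_pos j) (h.inv_tau_pow_pos j)).le,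
    ← ENNReal.ofReal_mul (mul_pos (h.inv_tau_pow_pos j) (h.inv_tau_pow_pos j)).le, ← pow_two,
    inv_pow_mul_jacobian h.τ_pos.ne' (by norm_num)]

/-- **Strip integral of the dissipation**:
`∫⁻_{[t_j,t_{j+1}) × ℝ³} |D𝔲|² = τʲ ∫⁻_{[0,T) × ℝ³} |Du|²` (Ożański 2017, §2:
`∫_{t_j}^{t_{j+1}}‖∇u^{(j)}‖² = τʲ ∫₀ᵀ‖∇u‖²`). [cite: Ozanski2017NSISingular, §2 p. 7] -/
theorem setLIntegral_strip_frobeniusNormSq_glue (h : IsNSIBlock T ν₀ τ z G u) (j : ℕ) :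
    ∫⁻ q in Ico (switchTime T τ j) (switchTime T τ (j + 1)) ×ˢ (univ : Set (EuclideanSpace ℝ (Fin 3))),
        ENNReal.ofReal (frobeniusNormSq (fderiv ℝ (glue T τ z u q.1) q.2)) =
      ENNReal.ofReal (τ ^ j) *
        ∫⁻ q in Ico 0 T ×ˢ (univ : Set (EuclideanSpace ℝ (Fin 3))),
          ENNReal.ofReal (frobeniusNormSq (fderiv ℝ (u q.1) q.2)) := by
  rw [setLIntegral_congr_fun (measurableSet_Ico.prod MeasurableSet.univ)
    (fun q hq => by rw [h.fderiv_glue_eq_smul_stPull (mem_prod.1 hq).1 q.2]),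
    ← h.preimage_stAffine_eq_strip j,
    setLIntegral_frobeniusNormSq_stRescale (h.inv_tau_pow_pos _) (h.inv_tau_pow_pos _), jacobian_eq,
    ← ENNReal.ofReal_mul (by positivity)]
  congr 2
  have := inv_pow_mul_jacobian h.τ_pos.ne' (show 4 ≤ 5 by norm_num) j
  rw [show ((τ⁻¹) ^ j * (τ⁻¹) ^ j) ^ 2 = ((τ⁻¹) ^ j) ^ 4 by ring, this]
  norm_num

/-- **Strip integral of the pressure term**:
`∫⁻_{[t_j,t_{j+1}) × ℝ³} |p̃[𝔲]| |𝔲| = τ^{2j} ∫⁻_{[0,T) × ℝ³} |p̃[u]| |u|`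
(Scheffer 1985, (2.34): "`|u||p|` are integrable"). [cite: Scheffer1985, proof of Lemma 2.3 (2.34)] -/
theorem setLIntegral_strip_pressure_mul_norm_glue (h : IsNSIBlock T ν₀ τ z G u) (j : ℕ) :
    ∫⁻ q in Ico (switchTime T τ j) (switchTime T τ (j + 1)) ×ˢ (univ : Set (EuclideanSpace ℝ (Fin 3))),
        ‖normalisedPressure (glue T τ z u q.1) q.2 * ‖glue T τ z u q.1 q.2‖‖ₑ =
      ENNReal.ofReal (τ ^ (2 * j)) *
        ∫⁻ q in Ico 0 T ×ˢ (univ : Set (EuclideanSpace ℝ (Fin 3))),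
          ‖normalisedPressure (u q.1) q.2 * ‖u q.1 q.2‖‖ₑ := by
  have h1 := setLIntegral_enorm_pow_stRescale (F := ℝ)
    (h.inv_tau_pow_pos (2 * j)) (h.inv_tau_pow_pos j) (-((τ⁻¹) ^ (2 * j) * switchTime T τ j))
    ((1 - (τ⁻¹) ^ j) • (1 - τ)⁻¹ • z) (((τ⁻¹) ^ j) ^ 3)
    (fun r y => normalisedPressure (u r) y * ‖u r y‖) (Ico 0 T ×ˢ univ) 1
  simp only [pow_one] at h1
  rw [setLIntegral_congr_fun (measurableSet_Ico.prod MeasurableSet.univ)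
    (fun q hq => by rw [h.pressure_mul_norm_glue_eq_smul_stPull (mem_prod.1 hq).1 q.2]),
    ← h.preimage_stAffine_eq_strip j, h1, jacobian_eq,
    Real.enorm_eq_ofReal (pow_pos (h.inv_tau_pow_pos j) 3).le,
    ← ENNReal.ofReal_mul (pow_pos (h.inv_tau_pow_pos j) 3).le, inv_pow_mul_jacobian h.τ_pos.ne' (by norm_num)]

end IsNSIBlock

end Literature.Barriers.NavierStokesRegularity

end
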